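import Summits.QuantumFields.BalabanUV.T4Continuum.Spine.NE5.TwoRunTorusWalkParametrix

/-!
# Spine/NE5/TwoRunTorusWalkParametrixTerm — `hPhol` ∧ `h226` for ONE term of NODE O's PARAMETRIX model IN ONE THEOREM:
# T33 §2 with the record's shape (§3) and the letter `det(1 − R) ≠ 0` from primitive letters (§5) plugged in
# (cell `pub-balaban-gaps`, seat `ne5` gen 10)

WHY.  T33 `TwoRunTorusWalkParametrix` discharged T25's σ-holomorphy input for GLUED-kernel records (§2), showed that g1-p2's
`ParametrixModelTerm.toKernels` has that shape with NODE A's symmetry ∕ positivity inputs free (§3), and derived the located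
letter `det(1 − R(σ,u)) ≠ 0` for the parametrix STEP family from its PRIMITIVE letters plus one smallness (§5) — but left
the assembly «§2 applies» to the reader (the file is at the 400-line limit).  THIS FILE is that assembly, ONE theorem per
parametrix term: `hol_and_h226_torus_of_parametrix_param` — inputs: the term `tm`, its walk record at `c⁺`, the step
family's primitive letters (exactly the hypotheses of g1-p2's `termWalkData_parametrix`) with (2.61) and ONE smallness
`K̄_R·m_S·(1+2∕κ_R)^ν < 1`, and T25's NON-WALK data only (Γ linear, potentials∕(2.20), χ∕(2.22), a Γ-slot fibre bound,
rates, `SmallTheta`, numerics); output: T25's conclusion for `tm.toKernels c⁺`.  The residual list of gate (c) for this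
family is thereby a single Lean signature with (i) σ-holomorphy and (ii) symmetry ∕ `Re ≻ 0` ABSENT.

HONEST FRAMING.  Pure composition of LANDED shapes (T33 §2∕§3∕§5; T25 beneath); every region, list, function and number
is a HYPOTHESIS; nothing of Bałaban's `C^{(k)}(Z₀,σ)`, `Γ_k(Z₀,σ)`, `𝐕_k`, `G′_□`, `K′` is constructed or asserted; a
MODEL-family feature (g1-plan-1 GEN 22 lens) — whether Bałaban's operators are such terms with printed constants is NODE
O's statement (v)⁺.  NE5 NOT PRINTED ∕ NOT PROVED; leaves 0∕12; (D4) 0∕1; spine 0∕9.  Rung (B)+1 on a FIXED finite T⁴ —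
NOT continuum, NOT infinite volume, NOT mass gap, NOT Clay.  0 sorry, 0 `def`.

Sources: [II] = T. Bałaban, CMP **116** (1988) [Balaban1988RG2Cluster] (1.11) p. 5, p. 13, p. 15, (2.14)–(2.26) pp. 15–17;
[B9] = CMP **99** (1985) [Balaban1985BackgroundPropagators] (3.87)–(3.90) p. 409, (3.107)–(3.108) p. 416, Thm 3.10
p. 416; C. King, CMP **102** (1986) [King1986] p. 665.  Nothing here is a claim about the Yang–Mills mass gap.
-/

noncomputable section

namespace Summit.QuantumFields.BalabanUV.T4Continuum.Spine.NE5.TwoRunTorusWalkParametrixTerm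

open Matrix Metric Set Finset
open Literature.MathematicalPhysics.QuantumFieldTheory.Balaban1983to89
open Literature.MathematicalPhysics.QuantumFieldTheory.Balaban1983to89.TreeLengthTorus (TPt TDom tsys)
open Literature.MathematicalPhysics.QuantumFieldTheory.Balaban1983to89.TreeLengthTorusTransfer (tclosure)
open Literature.MathematicalPhysics.QuantumFieldTheory.Balaban1983to89.B13Lemma3TorusData (TBond)
open Literature.MathematicalPhysics.QuantumFieldTheory.Balaban1983to89.B13Lemma3TorusTerms (weight Z0)
open Literature.MathematicalPhysics.QuantumFieldTheory.Balaban1983to89.B13Term214 (core214 F214 term214)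
open Literature.MathematicalPhysics.QuantumFieldTheory.Balaban1983to89.B13Bound143 (invTau)
open Literature.MathematicalPhysics.QuantumFieldTheory.Balaban1983to89.B5TorusCover (UT)
open Literature.MathematicalPhysics.QuantumFieldTheory.Balaban1983to89.B9Thm34Ext (toB6)
open Literature.MathematicalPhysics.QuantumFieldTheory.Balaban1983to89.B9Thm37GlueTorus (torusGeom tdist1)
open Literature.MathematicalPhysics.QuantumFieldTheory.Balaban1983to89.B11SectG (RowSum)
open Literature.MathematicalPhysics.QuantumFieldTheory.Balaban1983to89.B13TermWalkData (WalkConsts TermKernels TermWalkData)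
open Literature.MathematicalPhysics.QuantumFieldTheory.Balaban1983to89.B13TermWalkDataOneTorus (SmallTheta)
open Summit.QuantumFields.BalabanUV.Gaps.D4WalkModelParametrix (ParametrixModelTerm)
open Summit.QuantumFields.BalabanUV.Gaps.D4WalkBlock (blockNorm)
open Summit.QuantumFields.BalabanUV.Beta.UnitLatticeWalkInversion (Hd)
open Summit.QuantumFields.BalabanUV.T4Continuum.Spine.NE5.TwoRunTorusWalkParametrix
  (hol_and_h226_torus_of_gluedKernels_param parametrix_kernels_glued parametrix_A2_symm_posDef hdet_parametrix_step)

variable {d L N' : ℕ} [NeZero L] [NeZero N'] {M : ℕ}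
variable {ν : ℕ} {Nf : Fin ν → ℕ} [∀ i, NeZero (Nf i)]
variable {B : Type*} [NormedAddCommGroup B] [NormedSpace ℂ B]

open Classical in
/-- **`hPhol` ∧ `h226` FOR ONE TERM OF NODE O's PARAMETRIX MODEL, IN ONE THEOREM** — T33 §2 with §3 (the record's shape
by `rfl`, NODE A's symmetry ∕ `Re ≻ 0` free) and §5 (the letter `det(1 − R) ≠ 0` from the STEP family's primitive letters +
ONE smallness) PLUGGED IN.  Data: the physical constants `c`, the term `(Z, t)` with its lists and τ-regions; a parametrix
model term `tm` (skeleton `L` of local inverses `G′_□(u)`, partition `h`, `K′`; g1-p2's `Gaps.D4WalkModelParametrix`) with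
finitely many auxiliary columns; the WALK RECORD of its kernels at `c⁺` (`TermWalkData (tm.toKernels c⁺) w` — g1-p2's
`termWalkData_parametrix` along the seam, T18 `termWalkData_pencil` along NE5's pencil) for a package admissible at `α`;
the step family's PRIMITIVE letters on the `Rb`-ball (the hypotheses of `termWalkData_parametrix`: anchors, diameter `rD`,
`|J| ≤ m_J`, σ-terms meet `X`, multiplicity `n_D`, `#dom ≤ n_C`, `|h| ≤ 1` with supports in the domains, `G′_□` holomorphic
with block bound `C_L`, `K′` holomorphic with commutator block bound `λ_K` inside the domains), a window `κ_R + μ ≤ ρ_R`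
with (2.61) at rate `μ`, a site fibre bound `m_S`, and ONE smallness `K̄_R·m_S·(1+2∕κ_R)^ν < 1` at `κ₁ + 1`; then exactly
T25's remaining non-walk data: `Γ` linear with the glued kernel, the potentials `𝐕 b Y` holomorphic ∕ measurable with
(2.20), the common `χ, χᶜ, 𝐃` with (2.22), a common fibre bound for the Γ-slot, rates, `SmallTheta w α θ`, and the p. 17
numerics in the record's letters (jointly satisfiable — T34).  Conclusion = T25's for the record `tm.toKernels c⁺`: the
term is holomorphic in `b` on `ball 0 α` and obeys (2.26) there.  So for THIS family the per-term residual of gate (c) is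
literally: potentials∕(2.20), χ∕(2.22), the Γ-slot's column fibre bound, rates∕numerics.
[cite: Balaban1988RG2Cluster, (1.11) p.5, p.13, p.15, (2.14)–(2.16) pp.15–16, (2.20)–(2.26) pp.16–17; Balaban1985BackgroundPropagators, (3.87)–(3.90) p.409, Cor 3.8 p.410, (3.107)–(3.108) p.416, Thm 3.10 p.416; King1986, p.665] -/
theorem hol_and_h226_torus_of_parametrix_param (c : B13.Consts) (hκ₁ : 1 ≤ c.κ₁) (hα₆ : c.α₆ ≠ 0)
    (Z : TDom d N') (t : Finset (TDom d (L * N')) × Finset (TBond d M (L * N')))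
    (hpos : ∀ Y : TDom d (L * N'), 0 < invTau c ((tsys d (L * N')).dj Y))
    (hhalf : ∀ Y : TDom d (L * N'), invTau c ((tsys d (L * N')).dj Y) ≤ 1 / 2)
    {Uτ : TDom d (L * N') → Set ℂ} (hUτ : ∀ Y, IsOpen (Uτ Y))
    (hUtau : ∀ Y : TDom d (L * N'), closedBall (0 : ℂ) ((invTau c ((tsys d (L * N')).dj Y))⁻¹) ⊆ Uτ Y)
    {r : ℝ} (hr : 0 < r) (hr' : r ≤ Real.exp c.κ₁ - 1)
    (hsubτ : ∀ Y, ∀ s ∈ Set.uIcc (0 : ℝ) 1, closedBall (s : ℂ) r ⊆ Uτ Y)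
    (lZ : List (TPt d N')) (hlZ : lZ.Nodup ∧ lZ.toFinset = Z.1 \ tclosure L N' (Z0 M t))
    (lD : List (TDom d (L * N'))) (hlD : lD.Nodup ∧ lD.toFinset = t.1)
    -- NODE O's PARAMETRIX MODEL TERM, its record at `c⁺` (written out: `tm.toKernels c⁺`) and its walk objects
    (tm : ParametrixModelTerm d N' ν Nf B)
    [Fintype (tm.toKernels ({ c with κ₁ := c.κ₁ + 1 } : B13.Consts)).C₀]
    [DecidableEq (tm.toKernels ({ c with κ₁ := c.κ₁ + 1 } : B13.Consts)).C₀]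
    {w : WalkConsts} {α Rσ₀ : ℝ} (hw : w.Admissible α Rσ₀) (hα : 0 < α)
    (h𝒦 : TermWalkData (tm.toKernels ({ c with κ₁ := c.κ₁ + 1 } : B13.Consts)) w)
    -- THE STEP FAMILY's PRIMITIVE LETTERS (the hypotheses of g1-p2's `termWalkData_parametrix`) + ONE smallness
    -- → `hdet`
    {Rb CL lamK rD : ℝ} {mJ nD nC : ℕ} {ρR kapR μ cμ : ℝ}
    (hanchor : ∀ b, tm.L.anchor b ∈ tm.L.dom b) (hdiam : ∀ b, ∀ z ∈ tm.L.dom b, ∀ z' ∈ tm.L.dom b, tdist1 Nf z z' ≤ rD)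
    (hJ : ∀ b, (tm.L.J b).card ≤ mJ) (hX : ∀ b, (tm.L.J b).Nonempty → (tm.L.dom b ∩ tm.X).Nonempty)
    (hmult : ∀ z : UT Nf, (Finset.univ.filter fun b => tm.L.anchor b = z).card ≤ nD)
    (hsupp : ∀ b y, y ∉ tm.Es b → tm.h b y = 0) (habs : ∀ b y, |tm.h b y| ≤ 1)
    (hE : ∀ b y, y ∈ tm.Es b → tm.cubn y ∈ tm.L.dom b)
    (hLan : ∀ b i j, DifferentiableOn ℂ (fun u => tm.L.op b u i j) (ball (0 : B) Rb))
    (hLbd : ∀ b, ∀ u ∈ ball (0 : B) Rb, ∀ y y', blockNorm tm.cubn tm.cubn (tm.L.op b u) y y' ≤ CL) (hCL : 0 ≤ CL)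
    (hKan : ∀ i j, DifferentiableOn ℂ (fun u => tm.K' u i j) (ball (0 : B) Rb))
    (hKbd : ∀ b, ∀ u ∈ ball (0 : B) Rb, ∀ y y',
      blockNorm tm.cubn tm.cubn (Hd tm.h b * tm.K' u - tm.K' u * Hd tm.h b) y y' ≤ lamK) (hlamK : 0 ≤ lamK)
    (hKsupp : ∀ b u y y', blockNorm tm.cubn tm.cubn (Hd tm.h b * tm.K' u - tm.K' u * Hd tm.h b) y y' ≠ 0 →
      y ∈ tm.L.dom b ∧ y' ∈ tm.L.dom b)
    (hcard : ∀ b, (tm.L.dom b).card ≤ nC)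
    (hρR : 0 ≤ ρR) (hkapR : 0 < kapR) (hμ : 0 ≤ μ) (hwin : kapR + μ ≤ ρR)
    (hrow : RowSum (toB6 (torusGeom Nf 0 0 0) 0 True) μ cμ) (hcμ : 0 ≤ cμ)
    {mS : ℕ} (hfibS : ∀ x : UT Nf, (Finset.univ.filter fun j => tm.cubn j = x).card ≤ mS)
    (hsmallR : (((nC : ℝ) * lamK * CL) * Real.exp ((c.κ₁ + 1) * mJ) * Real.exp (2 * ρR * rD) * Real.exp (μ * rD)
      * ((nD : ℝ) * cμ)) * (mS * (1 + 2 / kapR) ^ ν) < 1) (hαRb : α ≤ Rb)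
    (Γ : B → (TPt d N' → ℂ) → ((tm.toKernels ({ c with κ₁ := c.κ₁ + 1 } : B13.Consts)).Λ ⊕ (tm.toKernels ({ c with κ₁
        := c.κ₁ + 1 } : B13.Consts)).C₀ → ℝ) → ((tm.toKernels ({ c with κ₁ := c.κ₁ + 1 } : B13.Consts)).Λ → ℂ))
    (hlin : ∀ b ∈ ball (0 : B) α, ∀ σ : TPt d N' → ℂ, (∀ j, σ j ∈ ball (0 : ℂ) (Real.exp (c.κ₁ + 1))) →
      ∀ X : (tm.toKernels ({ c with κ₁ := c.κ₁ + 1 } : B13.Consts)).Λ ⊕ (tm.toKernels ({ c with κ₁ := c.κ₁ + 1 } :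
        B13.Consts)).C₀ → ℝ, Γ b σ X = (tm.toKernels ({ c with κ₁ := c.κ₁ + 1 } : B13.Consts)).G2 σ b *ᵥ fun j => (X
        j : ℂ))
    (χY₀ χcP : ((tm.toKernels ({ c with κ₁ := c.κ₁ + 1 } : B13.Consts)).Λ → ℝ) → ℝ) (hχ0 : ∀ Bf, 0 ≤ χY₀ Bf) (hχc0 :
        ∀ Bf, 0 ≤ χcP Bf) (Dfam : Finset (TDom d (L * N')))
    (Vk : B → TDom d (L * N') → ((tm.toKernels ({ c with κ₁ := c.κ₁ + 1 } : B13.Consts)).Λ → ℝ) → ℂ)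
    -- NOT walk data and NOT structural: the potentials, measurability (NODE A's symmetry ∕ `Re ≻ 0` are FREE here)
    (hVholb : ∀ Y Bf, DifferentiableOn ℂ (fun b => Vk b Y Bf) (ball (0 : B) α))
    (hχm : Measurable χY₀) (hχcm : Measurable χcP) (hVm : ∀ b ∈ ball (0 : B) α, ∀ Y, Measurable (Vk b Y))
    -- the (2.22) shape, and (2.20) on the open PER-DOMAIN τ-region, uniform in `b`
    {γ₂ rP a₂₀ w₂₀ : ℝ} (qP : ((tm.toKernels ({ c with κ₁ := c.κ₁ + 1 } : B13.Consts)).Λ → ℝ) → ℝ)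
    (h222 : ∀ Bf, χY₀ Bf * χcP Bf ≤ Real.exp (-(γ₂ / 2 * rP ^ 2 * (t.2.card : ℕ)) + γ₂ / 2 * qP Bf))
    (hγ₂ : 0 ≤ γ₂) (hqP : ∀ Bf, qP Bf ≤ Bf ⬝ᵥ Bf) (ha0 : 0 ≤ a₂₀)
    (h220U : ∀ b ∈ ball (0 : B) α, ∀ τ : TDom d (L * N') → ℂ, (∀ Y, τ Y ∈ Uτ Y) →
      ∀ Bf, ∑ Y ∈ Dfam, ‖τ Y‖ * ‖Vk b Y Bf‖ ≤ a₂₀ / 2 * (Bf ⬝ᵥ Bf) + w₂₀)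
    -- a common fibre bound for the Γ-slot (located typing point (x10))
    {m : ℕ} (hm : (tm.toKernels ({ c with κ₁ := c.κ₁ + 1 } : B13.Consts)).m ≤ m) (hfibN : ∀ x : UT Nf,
        (Finset.univ.filter fun j => (tm.toKernels ({ c with κ₁ := c.κ₁ + 1 } : B13.Consts)).locN j = x).card ≤ m)
    -- rates, NODE A's smallness by name, the remaining numerics in the record's letters
    {κa κb kap' kap'' θ : ℝ} (hκa : κa < w.kap) (hκb : κb < κa) (h2 : kap' < κb) (h1 : kap'' < kap')
    (hkap'' : 0 < kap'') (hsm : SmallTheta w α θ)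
    (hθR1le : (m * (1 + 2 / (κb - kap')) ^ ν) * (m * (1 + 2 / (kap' - kap'')) ^ ν)
      * ((2 * w.KbarΓ * Real.exp (-(w.ε * w.Rσ)) + 2 * w.KbarΓ * α / w.R) * w.KbarC * w.KbarΓ
        + w.KbarΓ * (w.KbarC * (2 * w.KbarE * Real.exp (-(w.ε * w.Rσ)) + 2 * w.KbarE * α / w.R)
            * ((tm.toKernels ({ c with κ₁ := c.κ₁ + 1 } : B13.Consts)).m * (1 + 2 / (w.kap - κa)) ^ ν) * w.KbarC *
        ((tm.toKernels ({ c with κ₁ := c.κ₁ + 1 } : B13.Consts)).m * (1 + 2 / (κa - κb)) ^ ν)) * w.KbarΓ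
        + w.KbarΓ * w.KbarC * (2 * w.KbarΓ * Real.exp (-(w.ε * w.Rσ)) + 2 * w.KbarΓ * α / w.R)) ≤ θ)
    (hsmallKθ : w.KbarC * (m * (1 + 2 / κb) ^ ν) * (θ * (m * (1 + 2 / kap'') ^ ν)) < 1)
    {cE g : ℝ} (hc0 : 0 ≤ cE) (hc : ∀ k, (tm.toKernels ({ c with κ₁ := c.κ₁ + 1 } : B13.Consts)).hC.1.eigenvalues k ≤
        cE)
    (hαc : (2 * (θ * (m * (1 + 2 / kap'') ^ ν)) + (γ₂ + a₂₀)) * cE ≤ 1 / 2) (hg : 0 ≤ g)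
    (hΓq : ∀ X : (tm.toKernels ({ c with κ₁ := c.κ₁ + 1 } : B13.Consts)).Λ ⊕ (tm.toKernels ({ c with κ₁ := c.κ₁ + 1 }
        : B13.Consts)).C₀ → ℝ, ((tm.toKernels ({ c with κ₁ := c.κ₁ + 1 } : B13.Consts)).Γ₀ *ᵥ X) ⬝ᵥ ((tm.toKernels ({
        c with κ₁ := c.κ₁ + 1 } : B13.Consts)).C *ᵥ ((tm.toKernels ({ c with κ₁ := c.κ₁ + 1 } : B13.Consts)).Γ₀ *ᵥ
        X)) ≤ g * (X ⬝ᵥ X))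
    (hsmall : (2 * (θ * (m * (1 + 2 / kap'') ^ ν)) + (γ₂ + a₂₀)) * (1 + 2 * cE * g) ≤ 1 / 2)
    {a a₅ : ℝ} (hPa : a ≤ γ₂ * rP ^ 2)
    (hvol : 2 * (w.KbarC * (m * (1 + 2 / κb) ^ ν) * (θ * (m * (1 + 2 / kap'') ^ ν))
              * (1 + (1 - w.KbarC * (m * (1 + 2 / κb) ^ ν) * (θ * (m * (1 + 2 / kap'') ^ ν)))⁻¹) / 2)
          * (Fintype.card (tm.toKernels ({ c with κ₁ := c.κ₁ + 1 } : B13.Consts)).Λ : ℝ)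
        + w₂₀ + (2 * (θ * (m * (1 + 2 / kap'') ^ ν)) + (γ₂ + a₂₀)) * cE * (Fintype.card (tm.toKernels ({ c with κ₁ :=
        c.κ₁ + 1 } : B13.Consts)).Λ : ℝ)
        + (2 * (θ * (m * (1 + 2 / kap'') ^ ν)) + (γ₂ + a₂₀)) * (1 + 2 * cE * g) * (Fintype.card ((tm.toKernels ({ c
        with κ₁ := c.κ₁ + 1 } : B13.Consts)).Λ ⊕ (tm.toKernels ({ c with κ₁ := c.κ₁ + 1 } : B13.Consts)).C₀) : ℝ)
        ≤ a₅ * ((Z.1).card : ℝ)) :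
    DifferentiableOn ℂ
        (fun b => term214 r lZ lD (core214 (fun σ => (tm.toKernels ({ c with κ₁ := c.κ₁ + 1 } : B13.Consts)).A2 σ b)
        (Γ b) (F214 t.2.card χY₀ χcP Dfam (Vk b))) 0 0)
        (ball (0 : B) α) ∧
      ∀ b ∈ ball (0 : B) α,
        ‖term214 r lZ lD (core214 (fun σ => (tm.toKernels ({ c with κ₁ := c.κ₁ + 1 } : B13.Consts)).A2 σ b) (Γ b)
        (F214 t.2.card χY₀ χcP Dfam (Vk b))) 0 0‖ ≤
          weight L M c Z a t * Real.exp (a₅ * ((Z.1).card : ℝ)) := by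
  -- §3: the record's shape; §5: the letter `hdet` from the step family's primitive letters at `c⁺`
  have hshape := parametrix_kernels_glued ({ c with κ₁ := c.κ₁ + 1 } : B13.Consts) tm
  have hκ₁' : 0 ≤ ({ c with κ₁ := c.κ₁ + 1 } : B13.Consts).κ₁ := by
    show (0 : ℝ) ≤ c.κ₁ + 1
    linarith
  have hdet : ∀ b ∈ ball (0 : B) α, ∀ σ : TPt d N' → ℂ, (∀ j, σ j ∈ ball (0 : ℂ) (Real.exp (c.κ₁ + 1))) →
      ((1 : Matrix tm.n tm.n ℂ) + (-1 : ℂ) • tm.stepT.kernel σ b).det ≠ 0 := fun b hb σ hσ =>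
    hdet_parametrix_step ({ c with κ₁ := c.κ₁ + 1 } : B13.Consts) hκ₁' tm hanchor hdiam hJ hX hmult hsupp habs hE hLan
      hLbd hCL hKan hKbd hlamK hKsupp hcard hρR hkapR hμ hwin hrow hcμ hfibS hsmallR σ
      (fun j => (mem_ball_zero_iff.1 (hσ j)).le) b (ball_subset_ball hαRb hb)
  exact hol_and_h226_torus_of_gluedKernels_param c hκ₁ hα₆ Z t hpos hhalf hUτ hUtau hr hr' hsubτ lZ hlZ lD hlD
    (tm.toKernels ({ c with κ₁ := c.κ₁ + 1 } : B13.Consts)) hw hα h𝒦 (fun _ => (1 : Matrix tm.Λ tm.Λ ℂ)) tm.seedT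
    tm.stepT tm.rowOf tm.colOf hshape.1 hshape.2 hdet Γ hlin χY₀ χcP hχ0 hχc0 Dfam Vk hVholb hχm hχcm hVm
    (fun b _ σ _ => (parametrix_A2_symm_posDef ({ c with κ₁ := c.κ₁ + 1 } : B13.Consts) tm σ b).1)
    (fun b _ σ _ => (parametrix_A2_symm_posDef ({ c with κ₁ := c.κ₁ + 1 } : B13.Consts) tm σ b).2) qP h222 hγ₂ hqP
    ha0 h220U hm hfibN hκa hκb h2 h1 hkap'' hsm hθR1le hsmallKθ hc0 hc hαc hg hΓq hsmall hPa hvol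

end Summit.QuantumFields.BalabanUV.T4Continuum.Spine.NE5.TwoRunTorusWalkParametrixTerm

end
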